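import Summits.QuantumFields.YangMills.Theorems.BalabanUVNodesN11TStepInnerCentralWindowChartAtRegionsOfNesting
import Summits.QuantumFields.YangMills.Theorems.BalabanUVNodesN11PlaqSmallOfSect3EventsNumerics

/-!
# DAG node N11 — p642434∕p643422's knit with n11-w2's SCALAR numerics: the kernel-level LEFT side of (O3′) ∕ def-T's (†) at def-R's regions on the central α-window, support
# clause discharged, the four displayed rows `0 < sideD`, `3L^{k+1} + ((d+4)L+2)ΣL^l + 2 ≤ sideχ`, `hα3`, `hα2` replaced by `1 ≤ M`, `(d+4)L + 3 ≤ L·M₂`, `hε3`, `hε2`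

HEADER — WORK-UNIT METADATA.  Cell `pub-ymgap`, YM-PLAN Track A (HUMAN RULING D-0062), seat `pub-ymgap-dag-n08-w2` (g10; WIDTH SEAT 2∕4 on N08 [B10], RE-POINTED to
N11's [III] §3-supply residue), route `BalabanUVNodes`, key item K1⁷ `StabilityBAtRecordR13SepCoPH` = stmt-QuantumFields-20542 (helper lane, `--kind proof --supports 20542
--as helper` — jail key; K1⁹ stmt-QuantumFields-27364 is the K1-face of record, mis-key rule; count-neutral; (B4)-socket bookkeeping).  [III] = [Balaban1988Convergent],
[I] = [Balaban1987RG1], [B7] = [Balaban1985Averaging].  FILE 17 of this seat's kernel-level socket = p642434∕p643422 `…nnerCentralWindowChartAtRegionsOfNesting` (§2–§6) composed BY NAME with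
dag-n11-w2 g4's `…N11PlaqSmallOfSect3EventsNumerics` (`sideD_pos_of_one_le`, `collar3_le_sideχ_of`, `prop2_row3_div_sq_of`, `prop2_row2_div_sq_of`: the rows `0 < sideD`,
`3L^{k+1} + ((d+4)L+2)·Σ_{l<k}L^l + 2 ≤ sideχ`, [B7] Prop.-2 `hα3`∕`hα2` FROM the scalars `1 ≤ M`, `(d+4)L + 3 ≤ L·M₂`, `hε3 : 143((d+4)²∕4)²·ε_{k+1} ≤ 1∕3`, `hε2 : 2ε_{k+1} ≤ 2δ_N∕((d+4)L)²`
— dag-n11-w3 g3's `…N11NoExpansionNumerics` row shapes).  CONSUMED BY NAME, nothing modified.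

WHY THIS FILE.  After p642434∕p643422 the central-window road's kernel-level LEFT side of (O3′) at def-R's regions displays only `θ.Provisos₁₃CoPH`, `hslot` (resp. (H-U) + K0b's
residuals) and numerics; four of those numerics still carried def-T's cube letters (`sideD`, `sideχ`) and [B7] Prop. 2's derived thresholds.  dag-n11-w2 g4 reduced them to SCALAR
inequalities in `L, d, M, M₂, ε_{k+1}, δ_N`; this file passes the reduction through the knit (one-line compositions), so that a consumer reads: `θ.Provisos₁₃CoPH` (resp. the rows
`hw`∕`hwj`∕`hχ`∕`hT`∕`hGi`), `hslot` ∕ (H-U) + residuals (none at `k = 0`), the α-guards, `((d+2)L)²∕4·(4·(2δ_k) + 2ε_{k+1}∕L²) ≤ α`, `0 ≤ δ_k`, `0 < ε_{k+1}`, `hε3`, `hε2`, `1 ≤ M`,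
`(d+4)L + 3 ≤ L·M₂`, `L·M₂ ∣ M`, `sideD ∣ sitesPerDir 0`.

WHAT THIS FILE PROVES (0 `def`, 0 `sorry`, standard axioms).
★★★ `exists_ae_forall_slotsTOfRecord₁₃H_succ_eq_kernelRTOfRecord_atRegions_of_provisos_of_scalars` (all `k`) · ★★★ `…_one_eq_…_of_provisos_of_scalars` (`k = 0`) ·
★★★ `…_succ_eq_…_of_provisos_of_scalars_of_residuals` (all `k`, `hslot` discharged) · ★★ `exists_ae_forall_tstepOfRecord_eq_kernelRTOfRecord_atRegions_of_scalars` ·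
★★ `exists_ae_forall_tstepOfRecord_zero_eq_kernelRTOfRecord_atRegions_of_scalars`.

HONEST FRAMING.  Helper lane of K1⁷ (aside key); count-neutral; one-line compositions; the scalars, the nesting divisibilities, `hslot` ∕ (H-U) ∕ residuals and `θ.Provisos₁₃CoPH`
REMAIN HYPOTHESES, displayed; NO chart of Bałaban's asserted; nothing of Bałaban ([I] §2, [III] §3, Thm 1–2) asserted; (B4)∕(S-α)∕(O3′) NOT closed; N11 NOT discharged; N08 untouched;
K1⁷∕K1⁸∕K1⁹ NOT closed, no registered stub touched; counts unmoved (typed 28∕28 · discharged 5∕27 · A 5∕28).  One finite `𝕋⁴_{L^K}` programme at fixed `ε = L^{−K}`; R4 closes only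
the conditional finite-𝕋⁴ rung `BalabanLadder.UV` — NOT ℝ⁴, NOT OS, NOT a mass gap, NOT Clay.  No `sorry`, `axiom`, `def`, `instance`, `notation`.
Sources (SHAPE ∕ bookkeeping only): [III] (2.1) p.254, (2.16)–(2.18) p.257, (2.21) p.258, (3.1) p.264, (3.2)–(3.5) p.265, (3.24)–(3.25) p.270; [I] (0.4) p.253; [B7] Prop. 2 p.26.
-/

noncomputable section

open MeasureTheory ProbabilityTheory Set Function
open scoped ENNReal NNReal BigOperators

namespace Summit.QuantumFields.YangMills.Theorems.BalabanUVNodesN11TStepInnerCentralWindowChartAtRegionsOfScalars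

open Literature.MathematicalPhysics.QuantumFieldTheory.Balaban1983to89
open Literature.MathematicalPhysics.QuantumFieldTheory.Balaban1983to89.T4AveragingDisintegration
open Literature.MathematicalPhysics.QuantumFieldTheory.Balaban1983to89.BlockAveraging (Small Idx avgFun loopHol)
open Literature.MathematicalPhysics.QuantumFieldTheory.Balaban1983to89.BlockAveragingHaarAC (centralBond pre post centralBond_injective isLocal_avgFun)
open Literature.MathematicalPhysics.QuantumFieldTheory.Balaban1983to89.BlockAveragingEMLHaarAC (fibreFamily offCard)
open Literature.MathematicalPhysics.QuantumFieldTheory.Balaban1983to89.ExpMeanLog (expMeanLogSU deltaSU)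
open BalabanUVNodesN11TStepInnerCentralWindowChartAtRegions BalabanUVNodesN11TStepInnerCentralWindowChartAtRegionsOfNesting
open BalabanUVNodesN11PlaqSmallOfSect3EventsNumerics (sideD_pos_of_one_le collar3_le_sideχ_of prop2_row3_div_sq_of prop2_row2_div_sq_of)

open Node00 hiding SU
open T4Continuum
open B10Eq42TorusConstraint (bondsIn)

variable {F : T4Family} {N : ℕ} [NeZero N] (p : B12.RunParams) {k : ℕ}

/-- **★★★ ALL `k`, SCALAR NUMERICS**: p642434 §2 with `hD`∕`hR`∕`hα3`∕`hα2` supplied by dag-n11-w2's scalar reductions. [cite: Balaban1988Convergent, (2.18) p.257, (2.21) p.258, (3.1) p.264, (3.2)–(3.5) p.265, (3.24)–(3.25) p.270; Balaban1987RG1, (0.4) p.253; Balaban1985Averaging, Prop. 2 p.26] -/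
theorem exists_ae_forall_slotsTOfRecord₁₃H_succ_eq_kernelRTOfRecord_atRegions_of_provisos_of_scalars (θ : Stage13HParams F N) (h : θ.Provisos₁₃CoPH F N)
    (hk : k < p.K) {α : ℝ} (hα0 : 0 ≤ α) (hα : α ≤ 1 / 24) (hαδ : α < deltaSU (Fin N))
    (hgap : ∀ c : PBond (F.P p.K) (k + 1), (offCard c : ℝ) / (Fintype.card (Idx (F.P p.K)) : ℝ) + 150 * α < 1)
    (hδk : 0 ≤ deltaOfRecord θ.ν (gOfRecord₁₃ F N θ.toStage13Params p) k θ.A₁) (hε : 0 < epsOfRecord θ.ν (gOfRecord₁₃ F N θ.toStage13Params p) (k + 1))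
    (hδα : ((((F.P p.K).d + 2) * (F.P p.K).L : ℕ) : ℝ) ^ 2 / 4 * (4 * (2 * deltaOfRecord θ.ν (gOfRecord₁₃ F N θ.toStage13Params p) k θ.A₁) + 2 * (epsOfRecord θ.ν (gOfRecord₁₃ F N θ.toStage13Params p) (k + 1) / ((F.P p.K).L : ℝ) ^ 2)) ≤ α)
    (hε3 : (143 * (((((F.P p.K).d + 4 : ℕ) : ℝ)) ^ 2 / 4) ^ 2) * epsOfRecord θ.ν (gOfRecord₁₃ F N θ.toStage13Params p) (k + 1) ≤ 1 / 3)
    (hε2 : 2 * epsOfRecord θ.ν (gOfRecord₁₃ F N θ.toStage13Params p) (k + 1) ≤ 2 * deltaSU (Fin N) / ((((F.P p.K).d + 4) * (F.P p.K).L : ℕ) : ℝ) ^ 2)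
    (hM : 1 ≤ θ.τ9.M) (hLM₂ : ((F.P p.K).d + 4) * (F.P p.K).L + 3 ≤ (F.P p.K).L * θ.ν.M₂)
    (hslot : ∀ s₀ : SeqOfRecord F θ.ν θ.τ9.M (gOfRecord₁₃ F N θ.toStage13Params p) p.K k,
      Measurable (slotsOfRecord F N θ.ν θ.τ9 (EOfRecord₁₃ F N θ.toStage13Params) (wOfRecord₉ F N θ.toStage9Params) θ.ppSel p (gOfRecord₁₃ F N θ.toStage13Params p) k s₀))
    (hdiv : (F.P p.K).L * θ.ν.M₂ ∣ θ.τ9.M) (hPC : sideD F θ.ν θ.τ9.M p (gOfRecord₁₃ F N θ.toStage13Params p) k ∣ (F.P p.K).sitesPerDir 0) :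
    ∃ (T : PBond (F.P p.K) (k + 1) → GaugeField (F.P p.K) k (SU N) → Set (SU N))
      (ϑ : PBond (F.P p.K) (k + 1) → GaugeField (F.P p.K) k (SU N) → SU N → SU N)
      (jd : PBond (F.P p.K) (k + 1) → GaugeField (F.P p.K) k (SU N) → SU N → ℝ≥0),
      (∀ c, MeasurableSet {q : GaugeField (F.P p.K) k (SU N) × SU N | q.2 ∈ T c q.1}) ∧
      (∀ c, Measurable fun q : GaugeField (F.P p.K) k (SU N) × SU N => ϑ c q.1 q.2) ∧
      (∀ c, Measurable fun q : GaugeField (F.P p.K) k (SU N) × SU N => jd c q.1 q.2) ∧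
      ∀ᵐ V' ∂(fieldMeasure (F.P p.K) (k + 1) (SU N)), ∀ s : SeqOfRecord F θ.ν θ.τ9.M (gOfRecord₁₃ F N θ.toStage13Params p) p.K (k + 1),
        slotsTOfRecord F N θ.ν θ.τ9 (EOfRecord₁₃ F N θ.toStage13Params) (wOfRecord₉ F N θ.toStage9Params) θ.ppSel p (gOfRecord₁₃ F N θ.toStage13Params p) (k + 1) s V' =
          kernelRTOfRecord F N p.K k (Set.toFinite (bondsIn k (s.Ω (k + 1))ᶜ)).toFinset (Set.toFinite (bondsIn (k + 1) (s.Ω (k + 1))ᶜ)).toFinset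
            (fun y => ∫ uin,
              (({z : ((↥(Set.toFinite (bondsIn k (s.Ω (k + 1))ᶜ)).toFinset → SU N) ×
                    ({c : PBond (F.P p.K) (k + 1) // c ∉ (Set.toFinite (bondsIn (k + 1) (s.Ω (k + 1))ᶜ)).toFinset} → SU N)) ×
                    ({b : PBond (F.P p.K) k // b ∉ (Set.toFinite (bondsIn k (s.Ω (k + 1))ᶜ)).toFinset} → SU N) |
                  ∀ c : {c : PBond (F.P p.K) (k + 1) // c ∉ (Set.toFinite (bondsIn (k + 1) (s.Ω (k + 1))ᶜ)).toFinset},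
                    z.1.2 c ∈ T c ((MeasurableEquiv.piEquivPiSubtypeProd (fun _ : PBond (F.P p.K) k => SU N)
                      (· ∈ (Set.toFinite (bondsIn k (s.Ω (k + 1))ᶜ)).toFinset)).symm (z.1.1, z.2))}.indicator
                (fun z => ∏ c : {c : PBond (F.P p.K) (k + 1) // c ∉ (Set.toFinite (bondsIn (k + 1) (s.Ω (k + 1))ᶜ)).toFinset},
                  jd c ((MeasurableEquiv.piEquivPiSubtypeProd (fun _ : PBond (F.P p.K) k => SU N)
                    (· ∈ (Set.toFinite (bondsIn k (s.Ω (k + 1))ᶜ)).toFinset)).symm (z.1.1, z.2)) (z.1.2 c))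
                ((y, (MeasurableEquiv.piEquivPiSubtypeProd (fun _ : PBond (F.P p.K) (k + 1) => SU N)
                  (· ∈ (Set.toFinite (bondsIn (k + 1) (s.Ω (k + 1))ᶜ)).toFinset) V').2), uin) : ℝ≥0) : ℝ) *
              ((fun U : GaugeField (F.P p.K) k (SU N) =>
                  wOfRecord₉ F N θ.toStage9Params p (gOfRecord₁₃ F N θ.toStage13Params p) k s U V' *
                    (chiSeqOfRecord F N θ.ν θ.τ9.M (gOfRecord₁₃ F N θ.toStage13Params p) p.K k s.init U *
                      slotsOfRecord F N θ.ν θ.τ9 (EOfRecord₁₃ F N θ.toStage13Params) (wOfRecord₉ F N θ.toStage9Params) θ.ppSel p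
                        (gOfRecord₁₃ F N θ.toStage13Params p) k s.init U))
                ((MeasurableEquiv.piEquivPiSubtypeProd (fun _ : PBond (F.P p.K) k => SU N)
                  (· ∈ (Set.toFinite (bondsIn k (s.Ω (k + 1))ᶜ)).toFinset)).symm (y,
                  extend (fun c : {c : PBond (F.P p.K) (k + 1) // c ∉ (Set.toFinite (bondsIn (k + 1) (s.Ω (k + 1))ᶜ)).toFinset} =>
                      (⟨centralBond (c : PBond (F.P p.K) (k + 1)), centralBond_not_mem_bondsInFinset_compl_Omega hk s c c.2⟩ :
                        {b : PBond (F.P p.K) k // b ∉ (Set.toFinite (bondsIn k (s.Ω (k + 1))ᶜ)).toFinset}))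
                    (fun c : {c : PBond (F.P p.K) (k + 1) // c ∉ (Set.toFinite (bondsIn (k + 1) (s.Ω (k + 1))ᶜ)).toFinset} =>
                      ϑ c ((MeasurableEquiv.piEquivPiSubtypeProd (fun _ : PBond (F.P p.K) k => SU N)
                        (· ∈ (Set.toFinite (bondsIn k (s.Ω (k + 1))ᶜ)).toFinset)).symm (y, uin))
                        ((MeasurableEquiv.piEquivPiSubtypeProd (fun _ : PBond (F.P p.K) (k + 1) => SU N)
                          (· ∈ (Set.toFinite (bondsIn (k + 1) (s.Ω (k + 1))ᶜ)).toFinset) V').2 c)) uin)))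
              ∂(Measure.pi fun _ : {b : PBond (F.P p.K) k // b ∉ (Set.toFinite (bondsIn k (s.Ω (k + 1))ᶜ)).toFinset} => (HaarData.haar : Measure (SU N))))
            (MeasurableEquiv.piEquivPiSubtypeProd (fun _ : PBond (F.P p.K) (k + 1) => SU N)
              (· ∈ (Set.toFinite (bondsIn (k + 1) (s.Ω (k + 1))ᶜ)).toFinset) V').1 :=
  exists_ae_forall_slotsTOfRecord₁₃H_succ_eq_kernelRTOfRecord_atRegions_of_provisos_of_nesting p θ h hk hα0 hα hαδ hgap hδk hε hδα
    (prop2_row3_div_sq_of (F.P p.K).L_pos hε.le hε3) (prop2_row2_div_sq_of (F.P p.K).L_pos hε.le hε2) (collar3_le_sideχ_of F θ.ν p (gOfRecord₁₃ F N θ.toStage13Params p) k hLM₂) hslot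
    (sideD_pos_of_one_le F θ.ν θ.τ9.M p (gOfRecord₁₃ F N θ.toStage13Params p) k hM) hdiv hPC

/-- **★★★ `k = 0`, SCALAR NUMERICS ONLY beside `θ.Provisos₁₃CoPH`**: p642434 §3 likewise. [cite: Balaban1988Convergent, Thm 1 p.262, (2.18) p.257, (3.1) p.264, (3.2)–(3.5) p.265, (3.24)–(3.25) p.270; Balaban1987RG1, (0.4) p.253; Balaban1985Averaging, Prop. 2 p.26] -/
theorem exists_ae_forall_slotsTOfRecord₁₃H_one_eq_kernelRTOfRecord_atRegions_of_provisos_of_scalars (θ : Stage13HParams F N) (h : θ.Provisos₁₃CoPH F N)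
    (hK : 0 < p.K) {α : ℝ} (hα0 : 0 ≤ α) (hα : α ≤ 1 / 24) (hαδ : α < deltaSU (Fin N))
    (hgap : ∀ c : PBond (F.P p.K) 1, (offCard c : ℝ) / (Fintype.card (Idx (F.P p.K)) : ℝ) + 150 * α < 1)
    (hδk : 0 ≤ deltaOfRecord θ.ν (gOfRecord₁₃ F N θ.toStage13Params p) 0 θ.A₁) (hε : 0 < epsOfRecord θ.ν (gOfRecord₁₃ F N θ.toStage13Params p) 1)
    (hδα : ((((F.P p.K).d + 2) * (F.P p.K).L : ℕ) : ℝ) ^ 2 / 4 * (4 * (2 * deltaOfRecord θ.ν (gOfRecord₁₃ F N θ.toStage13Params p) 0 θ.A₁) + 2 * (epsOfRecord θ.ν (gOfRecord₁₃ F N θ.toStage13Params p) 1 / ((F.P p.K).L : ℝ) ^ 2)) ≤ α)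
    (hε3 : (143 * (((((F.P p.K).d + 4 : ℕ) : ℝ)) ^ 2 / 4) ^ 2) * epsOfRecord θ.ν (gOfRecord₁₃ F N θ.toStage13Params p) 1 ≤ 1 / 3)
    (hε2 : 2 * epsOfRecord θ.ν (gOfRecord₁₃ F N θ.toStage13Params p) 1 ≤ 2 * deltaSU (Fin N) / ((((F.P p.K).d + 4) * (F.P p.K).L : ℕ) : ℝ) ^ 2)
    (hM : 1 ≤ θ.τ9.M) (hLM₂ : ((F.P p.K).d + 4) * (F.P p.K).L + 3 ≤ (F.P p.K).L * θ.ν.M₂)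
    (hdiv : (F.P p.K).L * θ.ν.M₂ ∣ θ.τ9.M) (hPC : sideD F θ.ν θ.τ9.M p (gOfRecord₁₃ F N θ.toStage13Params p) 0 ∣ (F.P p.K).sitesPerDir 0) :
    ∃ (T : PBond (F.P p.K) 1 → GaugeField (F.P p.K) 0 (SU N) → Set (SU N))
      (ϑ : PBond (F.P p.K) 1 → GaugeField (F.P p.K) 0 (SU N) → SU N → SU N)
      (jd : PBond (F.P p.K) 1 → GaugeField (F.P p.K) 0 (SU N) → SU N → ℝ≥0),
      (∀ c, MeasurableSet {q : GaugeField (F.P p.K) 0 (SU N) × SU N | q.2 ∈ T c q.1}) ∧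
      (∀ c, Measurable fun q : GaugeField (F.P p.K) 0 (SU N) × SU N => ϑ c q.1 q.2) ∧
      (∀ c, Measurable fun q : GaugeField (F.P p.K) 0 (SU N) × SU N => jd c q.1 q.2) ∧
      ∀ᵐ V' ∂(fieldMeasure (F.P p.K) 1 (SU N)), ∀ s : SeqOfRecord F θ.ν θ.τ9.M (gOfRecord₁₃ F N θ.toStage13Params p) p.K 1,
        slotsTOfRecord F N θ.ν θ.τ9 (EOfRecord₁₃ F N θ.toStage13Params) (wOfRecord₉ F N θ.toStage9Params) θ.ppSel p (gOfRecord₁₃ F N θ.toStage13Params p) 1 s V' =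
          kernelRTOfRecord F N p.K 0 (Set.toFinite (bondsIn 0 (s.Ω 1)ᶜ)).toFinset (Set.toFinite (bondsIn 1 (s.Ω 1)ᶜ)).toFinset
            (fun y => ∫ uin,
              (({z : ((↥(Set.toFinite (bondsIn 0 (s.Ω 1)ᶜ)).toFinset → SU N) ×
                    ({c : PBond (F.P p.K) 1 // c ∉ (Set.toFinite (bondsIn 1 (s.Ω 1)ᶜ)).toFinset} → SU N)) ×
                    ({b : PBond (F.P p.K) 0 // b ∉ (Set.toFinite (bondsIn 0 (s.Ω 1)ᶜ)).toFinset} → SU N) |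
                  ∀ c : {c : PBond (F.P p.K) 1 // c ∉ (Set.toFinite (bondsIn 1 (s.Ω 1)ᶜ)).toFinset},
                    z.1.2 c ∈ T c ((MeasurableEquiv.piEquivPiSubtypeProd (fun _ : PBond (F.P p.K) 0 => SU N)
                      (· ∈ (Set.toFinite (bondsIn 0 (s.Ω 1)ᶜ)).toFinset)).symm (z.1.1, z.2))}.indicator
                (fun z => ∏ c : {c : PBond (F.P p.K) 1 // c ∉ (Set.toFinite (bondsIn 1 (s.Ω 1)ᶜ)).toFinset},
                  jd c ((MeasurableEquiv.piEquivPiSubtypeProd (fun _ : PBond (F.P p.K) 0 => SU N)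
                    (· ∈ (Set.toFinite (bondsIn 0 (s.Ω 1)ᶜ)).toFinset)).symm (z.1.1, z.2)) (z.1.2 c))
                ((y, (MeasurableEquiv.piEquivPiSubtypeProd (fun _ : PBond (F.P p.K) 1 => SU N)
                  (· ∈ (Set.toFinite (bondsIn 1 (s.Ω 1)ᶜ)).toFinset) V').2), uin) : ℝ≥0) : ℝ) *
              ((fun U : GaugeField (F.P p.K) 0 (SU N) =>
                  wOfRecord₉ F N θ.toStage9Params p (gOfRecord₁₃ F N θ.toStage13Params p) 0 s U V' *
                    (chiSeqOfRecord F N θ.ν θ.τ9.M (gOfRecord₁₃ F N θ.toStage13Params p) p.K 0 s.init U *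
                      slotsOfRecord F N θ.ν θ.τ9 (EOfRecord₁₃ F N θ.toStage13Params) (wOfRecord₉ F N θ.toStage9Params) θ.ppSel p
                        (gOfRecord₁₃ F N θ.toStage13Params p) 0 s.init U))
                ((MeasurableEquiv.piEquivPiSubtypeProd (fun _ : PBond (F.P p.K) 0 => SU N)
                  (· ∈ (Set.toFinite (bondsIn 0 (s.Ω 1)ᶜ)).toFinset)).symm (y,
                  extend (fun c : {c : PBond (F.P p.K) 1 // c ∉ (Set.toFinite (bondsIn 1 (s.Ω 1)ᶜ)).toFinset} =>
                      (⟨centralBond (c : PBond (F.P p.K) 1), centralBond_not_mem_bondsInFinset_compl_Omega hK s c c.2⟩ :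
                        {b : PBond (F.P p.K) 0 // b ∉ (Set.toFinite (bondsIn 0 (s.Ω 1)ᶜ)).toFinset}))
                    (fun c : {c : PBond (F.P p.K) 1 // c ∉ (Set.toFinite (bondsIn 1 (s.Ω 1)ᶜ)).toFinset} =>
                      ϑ c ((MeasurableEquiv.piEquivPiSubtypeProd (fun _ : PBond (F.P p.K) 0 => SU N)
                        (· ∈ (Set.toFinite (bondsIn 0 (s.Ω 1)ᶜ)).toFinset)).symm (y, uin))
                        ((MeasurableEquiv.piEquivPiSubtypeProd (fun _ : PBond (F.P p.K) 1 => SU N)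
                          (· ∈ (Set.toFinite (bondsIn 1 (s.Ω 1)ᶜ)).toFinset) V').2 c)) uin)))
              ∂(Measure.pi fun _ : {b : PBond (F.P p.K) 0 // b ∉ (Set.toFinite (bondsIn 0 (s.Ω 1)ᶜ)).toFinset} => (HaarData.haar : Measure (SU N))))
            (MeasurableEquiv.piEquivPiSubtypeProd (fun _ : PBond (F.P p.K) 1 => SU N)
              (· ∈ (Set.toFinite (bondsIn 1 (s.Ω 1)ᶜ)).toFinset) V').1 :=
  exists_ae_forall_slotsTOfRecord₁₃H_one_eq_kernelRTOfRecord_atRegions_of_provisos_of_nesting p θ h hK hα0 hα hαδ hgap hδk hε hδα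
    (prop2_row3_div_sq_of (F.P p.K).L_pos hε.le hε3) (prop2_row2_div_sq_of (F.P p.K).L_pos hε.le hε2)
    (by have h3 := collar3_le_sideχ_of F θ.ν p (gOfRecord₁₃ F N θ.toStage13Params p) 0 hLM₂; rw [Finset.range_zero, Finset.sum_empty, mul_zero, add_zero, zero_add, pow_one] at h3; exact h3)
    (sideD_pos_of_one_le F θ.ν θ.τ9.M p (gOfRecord₁₃ F N θ.toStage13Params p) 0 hM) hdiv hPC

/-- **★★★ ALL `k`, SCALAR NUMERICS, `hslot` DISCHARGED** ((H-U) + K0b's residuals): p643422 §6 likewise. [cite: Balaban1988Convergent, (2.18) p.257, (2.21) p.258, (3.1) p.264, (3.2)–(3.5) p.265, (3.24)–(3.25) p.270; Balaban1987RG1, (0.4) p.253; Balaban1985Averaging, Prop. 2 p.26] -/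
theorem exists_ae_forall_slotsTOfRecord₁₃H_succ_eq_kernelRTOfRecord_atRegions_of_provisos_of_scalars_of_residuals (θ : Stage13HParams F N) (h : θ.Provisos₁₃CoPH F N) (hU : LocalBgMeasurable F N θ.ν) (hres : θ.toStage12Params.HasResidualsOfRecord F N)
    (hk : k < p.K) {α : ℝ} (hα0 : 0 ≤ α) (hα : α ≤ 1 / 24) (hαδ : α < deltaSU (Fin N))
    (hgap : ∀ c : PBond (F.P p.K) (k + 1), (offCard c : ℝ) / (Fintype.card (Idx (F.P p.K)) : ℝ) + 150 * α < 1)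
    (hδk : 0 ≤ deltaOfRecord θ.ν (gOfRecord₁₃ F N θ.toStage13Params p) k θ.A₁) (hε : 0 < epsOfRecord θ.ν (gOfRecord₁₃ F N θ.toStage13Params p) (k + 1))
    (hδα : ((((F.P p.K).d + 2) * (F.P p.K).L : ℕ) : ℝ) ^ 2 / 4 * (4 * (2 * deltaOfRecord θ.ν (gOfRecord₁₃ F N θ.toStage13Params p) k θ.A₁) + 2 * (epsOfRecord θ.ν (gOfRecord₁₃ F N θ.toStage13Params p) (k + 1) / ((F.P p.K).L : ℝ) ^ 2)) ≤ α)
    (hε3 : (143 * (((((F.P p.K).d + 4 : ℕ) : ℝ)) ^ 2 / 4) ^ 2) * epsOfRecord θ.ν (gOfRecord₁₃ F N θ.toStage13Params p) (k + 1) ≤ 1 / 3)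
    (hε2 : 2 * epsOfRecord θ.ν (gOfRecord₁₃ F N θ.toStage13Params p) (k + 1) ≤ 2 * deltaSU (Fin N) / ((((F.P p.K).d + 4) * (F.P p.K).L : ℕ) : ℝ) ^ 2)
    (hM : 1 ≤ θ.τ9.M) (hLM₂ : ((F.P p.K).d + 4) * (F.P p.K).L + 3 ≤ (F.P p.K).L * θ.ν.M₂)
    (hdiv : (F.P p.K).L * θ.ν.M₂ ∣ θ.τ9.M) (hPC : sideD F θ.ν θ.τ9.M p (gOfRecord₁₃ F N θ.toStage13Params p) k ∣ (F.P p.K).sitesPerDir 0) :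
    ∃ (T : PBond (F.P p.K) (k + 1) → GaugeField (F.P p.K) k (SU N) → Set (SU N))
      (ϑ : PBond (F.P p.K) (k + 1) → GaugeField (F.P p.K) k (SU N) → SU N → SU N)
      (jd : PBond (F.P p.K) (k + 1) → GaugeField (F.P p.K) k (SU N) → SU N → ℝ≥0),
      (∀ c, MeasurableSet {q : GaugeField (F.P p.K) k (SU N) × SU N | q.2 ∈ T c q.1}) ∧
      (∀ c, Measurable fun q : GaugeField (F.P p.K) k (SU N) × SU N => ϑ c q.1 q.2) ∧
      (∀ c, Measurable fun q : GaugeField (F.P p.K) k (SU N) × SU N => jd c q.1 q.2) ∧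
      ∀ᵐ V' ∂(fieldMeasure (F.P p.K) (k + 1) (SU N)), ∀ s : SeqOfRecord F θ.ν θ.τ9.M (gOfRecord₁₃ F N θ.toStage13Params p) p.K (k + 1),
        slotsTOfRecord F N θ.ν θ.τ9 (EOfRecord₁₃ F N θ.toStage13Params) (wOfRecord₉ F N θ.toStage9Params) θ.ppSel p (gOfRecord₁₃ F N θ.toStage13Params p) (k + 1) s V' =
          kernelRTOfRecord F N p.K k (Set.toFinite (bondsIn k (s.Ω (k + 1))ᶜ)).toFinset (Set.toFinite (bondsIn (k + 1) (s.Ω (k + 1))ᶜ)).toFinset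
            (fun y => ∫ uin,
              (({z : ((↥(Set.toFinite (bondsIn k (s.Ω (k + 1))ᶜ)).toFinset → SU N) ×
                    ({c : PBond (F.P p.K) (k + 1) // c ∉ (Set.toFinite (bondsIn (k + 1) (s.Ω (k + 1))ᶜ)).toFinset} → SU N)) ×
                    ({b : PBond (F.P p.K) k // b ∉ (Set.toFinite (bondsIn k (s.Ω (k + 1))ᶜ)).toFinset} → SU N) |
                  ∀ c : {c : PBond (F.P p.K) (k + 1) // c ∉ (Set.toFinite (bondsIn (k + 1) (s.Ω (k + 1))ᶜ)).toFinset},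
                    z.1.2 c ∈ T c ((MeasurableEquiv.piEquivPiSubtypeProd (fun _ : PBond (F.P p.K) k => SU N)
                      (· ∈ (Set.toFinite (bondsIn k (s.Ω (k + 1))ᶜ)).toFinset)).symm (z.1.1, z.2))}.indicator
                (fun z => ∏ c : {c : PBond (F.P p.K) (k + 1) // c ∉ (Set.toFinite (bondsIn (k + 1) (s.Ω (k + 1))ᶜ)).toFinset},
                  jd c ((MeasurableEquiv.piEquivPiSubtypeProd (fun _ : PBond (F.P p.K) k => SU N)
                    (· ∈ (Set.toFinite (bondsIn k (s.Ω (k + 1))ᶜ)).toFinset)).symm (z.1.1, z.2)) (z.1.2 c))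
                ((y, (MeasurableEquiv.piEquivPiSubtypeProd (fun _ : PBond (F.P p.K) (k + 1) => SU N)
                  (· ∈ (Set.toFinite (bondsIn (k + 1) (s.Ω (k + 1))ᶜ)).toFinset) V').2), uin) : ℝ≥0) : ℝ) *
              ((fun U : GaugeField (F.P p.K) k (SU N) =>
                  wOfRecord₉ F N θ.toStage9Params p (gOfRecord₁₃ F N θ.toStage13Params p) k s U V' *
                    (chiSeqOfRecord F N θ.ν θ.τ9.M (gOfRecord₁₃ F N θ.toStage13Params p) p.K k s.init U *
                      slotsOfRecord F N θ.ν θ.τ9 (EOfRecord₁₃ F N θ.toStage13Params) (wOfRecord₉ F N θ.toStage9Params) θ.ppSel p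
                        (gOfRecord₁₃ F N θ.toStage13Params p) k s.init U))
                ((MeasurableEquiv.piEquivPiSubtypeProd (fun _ : PBond (F.P p.K) k => SU N)
                  (· ∈ (Set.toFinite (bondsIn k (s.Ω (k + 1))ᶜ)).toFinset)).symm (y,
                  extend (fun c : {c : PBond (F.P p.K) (k + 1) // c ∉ (Set.toFinite (bondsIn (k + 1) (s.Ω (k + 1))ᶜ)).toFinset} =>
                      (⟨centralBond (c : PBond (F.P p.K) (k + 1)), centralBond_not_mem_bondsInFinset_compl_Omega hk s c c.2⟩ :
                        {b : PBond (F.P p.K) k // b ∉ (Set.toFinite (bondsIn k (s.Ω (k + 1))ᶜ)).toFinset}))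
                    (fun c : {c : PBond (F.P p.K) (k + 1) // c ∉ (Set.toFinite (bondsIn (k + 1) (s.Ω (k + 1))ᶜ)).toFinset} =>
                      ϑ c ((MeasurableEquiv.piEquivPiSubtypeProd (fun _ : PBond (F.P p.K) k => SU N)
                        (· ∈ (Set.toFinite (bondsIn k (s.Ω (k + 1))ᶜ)).toFinset)).symm (y, uin))
                        ((MeasurableEquiv.piEquivPiSubtypeProd (fun _ : PBond (F.P p.K) (k + 1) => SU N)
                          (· ∈ (Set.toFinite (bondsIn (k + 1) (s.Ω (k + 1))ᶜ)).toFinset) V').2 c)) uin)))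
              ∂(Measure.pi fun _ : {b : PBond (F.P p.K) k // b ∉ (Set.toFinite (bondsIn k (s.Ω (k + 1))ᶜ)).toFinset} => (HaarData.haar : Measure (SU N))))
            (MeasurableEquiv.piEquivPiSubtypeProd (fun _ : PBond (F.P p.K) (k + 1) => SU N)
              (· ∈ (Set.toFinite (bondsIn (k + 1) (s.Ω (k + 1))ᶜ)).toFinset) V').1 :=
  exists_ae_forall_slotsTOfRecord₁₃H_succ_eq_kernelRTOfRecord_atRegions_of_provisos_of_nesting_of_residuals p θ h hU hres hk hα0 hα hαδ hgap hδk hε hδα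
    (prop2_row3_div_sq_of (F.P p.K).L_pos hε.le hε3) (prop2_row2_div_sq_of (F.P p.K).L_pos hε.le hε2) (collar3_le_sideχ_of F θ.ν p (gOfRecord₁₃ F N θ.toStage13Params p) k hLM₂)
    (sideD_pos_of_one_le F θ.ν θ.τ9.M p (gOfRecord₁₃ F N θ.toStage13Params p) k hM) hdiv hPC

/-- **★★ def-T's (†) ∀ `s′`, ALL `k`, SCALAR NUMERICS** (generic letters): p642434 §4 likewise. [cite: Balaban1988Convergent, (2.18) p.257, (2.21) p.258, (3.1) p.264, (3.2)–(3.5) p.265; Balaban1987RG1, (0.4) p.253; Balaban1985Averaging, Prop. 2 p.26] -/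
theorem exists_ae_forall_tstepOfRecord_eq_kernelRTOfRecord_atRegions_of_scalars
    (ν : Stage7Numerics) (M : ℕ) (A₁ : ℝ) (ζ : ZetaOfRecord F N ν M) (g : ℕ → ℝ) (hk : k < p.K) (T' : SeqOfRecord F ν M g p.K k → Density (F.P p.K) k (SU N))
    {α : ℝ} (hα0 : 0 ≤ α) (hα : α ≤ 1 / 24) (hαδ : α < deltaSU (Fin N))
    (hgap : ∀ c : PBond (F.P p.K) (k + 1), (offCard c : ℝ) / (Fintype.card (Idx (F.P p.K)) : ℝ) + 150 * α < 1)
    (hδk : 0 ≤ deltaOfRecord ν g k A₁) (hε : 0 < epsOfRecord ν g (k + 1))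
    (hδα : ((((F.P p.K).d + 2) * (F.P p.K).L : ℕ) : ℝ) ^ 2 / 4 * (4 * (2 * deltaOfRecord ν g k A₁) + 2 * (epsOfRecord ν g (k + 1) / ((F.P p.K).L : ℝ) ^ 2)) ≤ α)
    (hε3 : (143 * (((((F.P p.K).d + 4 : ℕ) : ℝ)) ^ 2 / 4) ^ 2) * epsOfRecord ν g (k + 1) ≤ 1 / 3)
    (hε2 : 2 * epsOfRecord ν g (k + 1) ≤ 2 * deltaSU (Fin N) / ((((F.P p.K).d + 4) * (F.P p.K).L : ℕ) : ℝ) ^ 2)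
    (hM : 1 ≤ M) (hLM₂ : ((F.P p.K).d + 4) * (F.P p.K).L + 3 ≤ (F.P p.K).L * ν.M₂)
    (hw : ∀ s' V', Measurable fun U => wOfRecord F N ν M A₁ ζ p g k s' U V')
    (hwj : ∀ s', Measurable fun q : GaugeField (F.P p.K) (k + 1) (SU N) × GaugeField (F.P p.K) k (SU N) => wOfRecord F N ν M A₁ ζ p g k s' q.2 q.1)
    (hχ : ∀ s, Measurable (chiSeqOfRecord F N ν M g p.K k s)) (hT : ∀ s, Measurable (T' s))
    (hdiv : (F.P p.K).L * ν.M₂ ∣ M) (hPC : sideD F ν M p g k ∣ (F.P p.K).sitesPerDir 0)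
    (hGi : ∀ s' : SeqOfRecord F ν M g p.K (k + 1),
      Integrable (fun U => wOfRecord F N ν M A₁ ζ p g k s' U ((avOfRecord F N p.K k).avg U) * (chiSeqOfRecord F N ν M g p.K k s'.init U * T' s'.init U))
        (fieldMeasure (F.P p.K) k (SU N))) :
    ∃ (T : PBond (F.P p.K) (k + 1) → GaugeField (F.P p.K) k (SU N) → Set (SU N))
      (ϑ : PBond (F.P p.K) (k + 1) → GaugeField (F.P p.K) k (SU N) → SU N → SU N)
      (jd : PBond (F.P p.K) (k + 1) → GaugeField (F.P p.K) k (SU N) → SU N → ℝ≥0),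
      (∀ c, MeasurableSet {q : GaugeField (F.P p.K) k (SU N) × SU N | q.2 ∈ T c q.1}) ∧
      (∀ c, Measurable fun q : GaugeField (F.P p.K) k (SU N) × SU N => ϑ c q.1 q.2) ∧
      (∀ c, Measurable fun q : GaugeField (F.P p.K) k (SU N) × SU N => jd c q.1 q.2) ∧
      ∀ᵐ V' ∂(fieldMeasure (F.P p.K) (k + 1) (SU N)), ∀ s' : SeqOfRecord F ν M g p.K (k + 1),
        tstepOfRecord F N ν M (wOfRecord F N ν M A₁ ζ) p g k T' s' V' =
          kernelRTOfRecord F N p.K k (Set.toFinite (bondsIn k (s'.Ω (k + 1))ᶜ)).toFinset (Set.toFinite (bondsIn (k + 1) (s'.Ω (k + 1))ᶜ)).toFinset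
            (fun y => ∫ uin,
              (({z : ((↥(Set.toFinite (bondsIn k (s'.Ω (k + 1))ᶜ)).toFinset → SU N) ×
                    ({c : PBond (F.P p.K) (k + 1) // c ∉ (Set.toFinite (bondsIn (k + 1) (s'.Ω (k + 1))ᶜ)).toFinset} → SU N)) ×
                    ({b : PBond (F.P p.K) k // b ∉ (Set.toFinite (bondsIn k (s'.Ω (k + 1))ᶜ)).toFinset} → SU N) |
                  ∀ c : {c : PBond (F.P p.K) (k + 1) // c ∉ (Set.toFinite (bondsIn (k + 1) (s'.Ω (k + 1))ᶜ)).toFinset},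
                    z.1.2 c ∈ T c ((MeasurableEquiv.piEquivPiSubtypeProd (fun _ : PBond (F.P p.K) k => SU N)
                      (· ∈ (Set.toFinite (bondsIn k (s'.Ω (k + 1))ᶜ)).toFinset)).symm (z.1.1, z.2))}.indicator
                (fun z => ∏ c : {c : PBond (F.P p.K) (k + 1) // c ∉ (Set.toFinite (bondsIn (k + 1) (s'.Ω (k + 1))ᶜ)).toFinset},
                  jd c ((MeasurableEquiv.piEquivPiSubtypeProd (fun _ : PBond (F.P p.K) k => SU N)
                    (· ∈ (Set.toFinite (bondsIn k (s'.Ω (k + 1))ᶜ)).toFinset)).symm (z.1.1, z.2)) (z.1.2 c))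
                ((y, (MeasurableEquiv.piEquivPiSubtypeProd (fun _ : PBond (F.P p.K) (k + 1) => SU N)
                  (· ∈ (Set.toFinite (bondsIn (k + 1) (s'.Ω (k + 1))ᶜ)).toFinset) V').2), uin) : ℝ≥0) : ℝ) *
              ((fun U : GaugeField (F.P p.K) k (SU N) => wOfRecord F N ν M A₁ ζ p g k s' U V' * (chiSeqOfRecord F N ν M g p.K k s'.init U * T' s'.init U))
                ((MeasurableEquiv.piEquivPiSubtypeProd (fun _ : PBond (F.P p.K) k => SU N)
                  (· ∈ (Set.toFinite (bondsIn k (s'.Ω (k + 1))ᶜ)).toFinset)).symm (y,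
                  extend (fun c : {c : PBond (F.P p.K) (k + 1) // c ∉ (Set.toFinite (bondsIn (k + 1) (s'.Ω (k + 1))ᶜ)).toFinset} =>
                      (⟨centralBond (c : PBond (F.P p.K) (k + 1)), centralBond_not_mem_bondsInFinset_compl_Omega hk s' c c.2⟩ :
                        {b : PBond (F.P p.K) k // b ∉ (Set.toFinite (bondsIn k (s'.Ω (k + 1))ᶜ)).toFinset}))
                    (fun c : {c : PBond (F.P p.K) (k + 1) // c ∉ (Set.toFinite (bondsIn (k + 1) (s'.Ω (k + 1))ᶜ)).toFinset} =>
                      ϑ c ((MeasurableEquiv.piEquivPiSubtypeProd (fun _ : PBond (F.P p.K) k => SU N)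
                        (· ∈ (Set.toFinite (bondsIn k (s'.Ω (k + 1))ᶜ)).toFinset)).symm (y, uin))
                        ((MeasurableEquiv.piEquivPiSubtypeProd (fun _ : PBond (F.P p.K) (k + 1) => SU N)
                          (· ∈ (Set.toFinite (bondsIn (k + 1) (s'.Ω (k + 1))ᶜ)).toFinset) V').2 c)) uin)))
              ∂(Measure.pi fun _ : {b : PBond (F.P p.K) k // b ∉ (Set.toFinite (bondsIn k (s'.Ω (k + 1))ᶜ)).toFinset} => (HaarData.haar : Measure (SU N))))
            (MeasurableEquiv.piEquivPiSubtypeProd (fun _ : PBond (F.P p.K) (k + 1) => SU N)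
              (· ∈ (Set.toFinite (bondsIn (k + 1) (s'.Ω (k + 1))ᶜ)).toFinset) V').1 :=
  exists_ae_forall_tstepOfRecord_eq_kernelRTOfRecord_atRegions_of_nesting p ν M A₁ ζ g hk T' hα0 hα hαδ hgap hδk hε hδα
    (prop2_row3_div_sq_of (F.P p.K).L_pos hε.le hε3) (prop2_row2_div_sq_of (F.P p.K).L_pos hε.le hε2) (collar3_le_sideχ_of F ν p g k hLM₂) hw hwj hχ hT
    (sideD_pos_of_one_le F ν M p g k hM) hdiv hPC hGi

/-- **★★ def-T's (†) AT THE FIRST STEP, ALL LENGTH-1 HISTORIES, SCALAR NUMERICS** (generic letters; `hχ` discharged): p642434 §5 likewise. [cite: Balaban1988Convergent, (2.18) p.257, (2.21) p.258, (3.1) p.264, (3.2)–(3.5) p.265; Balaban1987RG1, (0.4) p.253; Balaban1985Averaging, Prop. 2 p.26] -/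
theorem exists_ae_forall_tstepOfRecord_zero_eq_kernelRTOfRecord_atRegions_of_scalars
    (ν : Stage7Numerics) (M : ℕ) (A₁ : ℝ) (ζ : ZetaOfRecord F N ν M) (g : ℕ → ℝ) (hK : 0 < p.K) (T' : SeqOfRecord F ν M g p.K 0 → Density (F.P p.K) 0 (SU N))
    {α : ℝ} (hα0 : 0 ≤ α) (hα : α ≤ 1 / 24) (hαδ : α < deltaSU (Fin N))
    (hgap : ∀ c : PBond (F.P p.K) 1, (offCard c : ℝ) / (Fintype.card (Idx (F.P p.K)) : ℝ) + 150 * α < 1)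
    (hδk : 0 ≤ deltaOfRecord ν g 0 A₁) (hε : 0 < epsOfRecord ν g 1)
    (hδα : ((((F.P p.K).d + 2) * (F.P p.K).L : ℕ) : ℝ) ^ 2 / 4 * (4 * (2 * deltaOfRecord ν g 0 A₁) + 2 * (epsOfRecord ν g 1 / ((F.P p.K).L : ℝ) ^ 2)) ≤ α)
    (hε3 : (143 * (((((F.P p.K).d + 4 : ℕ) : ℝ)) ^ 2 / 4) ^ 2) * epsOfRecord ν g 1 ≤ 1 / 3)
    (hε2 : 2 * epsOfRecord ν g 1 ≤ 2 * deltaSU (Fin N) / ((((F.P p.K).d + 4) * (F.P p.K).L : ℕ) : ℝ) ^ 2)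
    (hM : 1 ≤ M) (hLM₂ : ((F.P p.K).d + 4) * (F.P p.K).L + 3 ≤ (F.P p.K).L * ν.M₂)
    (hw : ∀ s' V', Measurable fun U => wOfRecord F N ν M A₁ ζ p g 0 s' U V')
    (hwj : ∀ s', Measurable fun q : GaugeField (F.P p.K) 1 (SU N) × GaugeField (F.P p.K) 0 (SU N) => wOfRecord F N ν M A₁ ζ p g 0 s' q.2 q.1)
    (hT : ∀ s, Measurable (T' s))
    (hdiv : (F.P p.K).L * ν.M₂ ∣ M) (hPC : sideD F ν M p g 0 ∣ (F.P p.K).sitesPerDir 0)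
    (hGi : ∀ s' : SeqOfRecord F ν M g p.K 1,
      Integrable (fun U => wOfRecord F N ν M A₁ ζ p g 0 s' U ((avOfRecord F N p.K 0).avg U) * (chiSeqOfRecord F N ν M g p.K 0 s'.init U * T' s'.init U))
        (fieldMeasure (F.P p.K) 0 (SU N))) :
    ∃ (T : PBond (F.P p.K) 1 → GaugeField (F.P p.K) 0 (SU N) → Set (SU N))
      (ϑ : PBond (F.P p.K) 1 → GaugeField (F.P p.K) 0 (SU N) → SU N → SU N)
      (jd : PBond (F.P p.K) 1 → GaugeField (F.P p.K) 0 (SU N) → SU N → ℝ≥0),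
      (∀ c, MeasurableSet {q : GaugeField (F.P p.K) 0 (SU N) × SU N | q.2 ∈ T c q.1}) ∧
      (∀ c, Measurable fun q : GaugeField (F.P p.K) 0 (SU N) × SU N => ϑ c q.1 q.2) ∧
      (∀ c, Measurable fun q : GaugeField (F.P p.K) 0 (SU N) × SU N => jd c q.1 q.2) ∧
      ∀ᵐ V' ∂(fieldMeasure (F.P p.K) 1 (SU N)), ∀ s' : SeqOfRecord F ν M g p.K 1,
        tstepOfRecord F N ν M (wOfRecord F N ν M A₁ ζ) p g 0 T' s' V' =
          kernelRTOfRecord F N p.K 0 (Set.toFinite (bondsIn 0 (s'.Ω 1)ᶜ)).toFinset (Set.toFinite (bondsIn 1 (s'.Ω 1)ᶜ)).toFinset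
            (fun y => ∫ uin,
              (({z : ((↥(Set.toFinite (bondsIn 0 (s'.Ω 1)ᶜ)).toFinset → SU N) ×
                    ({c : PBond (F.P p.K) 1 // c ∉ (Set.toFinite (bondsIn 1 (s'.Ω 1)ᶜ)).toFinset} → SU N)) ×
                    ({b : PBond (F.P p.K) 0 // b ∉ (Set.toFinite (bondsIn 0 (s'.Ω 1)ᶜ)).toFinset} → SU N) |
                  ∀ c : {c : PBond (F.P p.K) 1 // c ∉ (Set.toFinite (bondsIn 1 (s'.Ω 1)ᶜ)).toFinset},
                    z.1.2 c ∈ T c ((MeasurableEquiv.piEquivPiSubtypeProd (fun _ : PBond (F.P p.K) 0 => SU N)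
                      (· ∈ (Set.toFinite (bondsIn 0 (s'.Ω 1)ᶜ)).toFinset)).symm (z.1.1, z.2))}.indicator
                (fun z => ∏ c : {c : PBond (F.P p.K) 1 // c ∉ (Set.toFinite (bondsIn 1 (s'.Ω 1)ᶜ)).toFinset},
                  jd c ((MeasurableEquiv.piEquivPiSubtypeProd (fun _ : PBond (F.P p.K) 0 => SU N)
                    (· ∈ (Set.toFinite (bondsIn 0 (s'.Ω 1)ᶜ)).toFinset)).symm (z.1.1, z.2)) (z.1.2 c))
                ((y, (MeasurableEquiv.piEquivPiSubtypeProd (fun _ : PBond (F.P p.K) 1 => SU N)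
                  (· ∈ (Set.toFinite (bondsIn 1 (s'.Ω 1)ᶜ)).toFinset) V').2), uin) : ℝ≥0) : ℝ) *
              ((fun U : GaugeField (F.P p.K) 0 (SU N) => wOfRecord F N ν M A₁ ζ p g 0 s' U V' * (chiSeqOfRecord F N ν M g p.K 0 s'.init U * T' s'.init U))
                ((MeasurableEquiv.piEquivPiSubtypeProd (fun _ : PBond (F.P p.K) 0 => SU N)
                  (· ∈ (Set.toFinite (bondsIn 0 (s'.Ω 1)ᶜ)).toFinset)).symm (y,
                  extend (fun c : {c : PBond (F.P p.K) 1 // c ∉ (Set.toFinite (bondsIn 1 (s'.Ω 1)ᶜ)).toFinset} =>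
                      (⟨centralBond (c : PBond (F.P p.K) 1), centralBond_not_mem_bondsInFinset_compl_Omega hK s' c c.2⟩ :
                        {b : PBond (F.P p.K) 0 // b ∉ (Set.toFinite (bondsIn 0 (s'.Ω 1)ᶜ)).toFinset}))
                    (fun c : {c : PBond (F.P p.K) 1 // c ∉ (Set.toFinite (bondsIn 1 (s'.Ω 1)ᶜ)).toFinset} =>
                      ϑ c ((MeasurableEquiv.piEquivPiSubtypeProd (fun _ : PBond (F.P p.K) 0 => SU N)
                        (· ∈ (Set.toFinite (bondsIn 0 (s'.Ω 1)ᶜ)).toFinset)).symm (y, uin))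
                        ((MeasurableEquiv.piEquivPiSubtypeProd (fun _ : PBond (F.P p.K) 1 => SU N)
                          (· ∈ (Set.toFinite (bondsIn 1 (s'.Ω 1)ᶜ)).toFinset) V').2 c)) uin)))
              ∂(Measure.pi fun _ : {b : PBond (F.P p.K) 0 // b ∉ (Set.toFinite (bondsIn 0 (s'.Ω 1)ᶜ)).toFinset} => (HaarData.haar : Measure (SU N))))
            (MeasurableEquiv.piEquivPiSubtypeProd (fun _ : PBond (F.P p.K) 1 => SU N)
              (· ∈ (Set.toFinite (bondsIn 1 (s'.Ω 1)ᶜ)).toFinset) V').1 :=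
  exists_ae_forall_tstepOfRecord_zero_eq_kernelRTOfRecord_atRegions_of_nesting p ν M A₁ ζ g hK T' hα0 hα hαδ hgap hδk hε hδα
    (prop2_row3_div_sq_of (F.P p.K).L_pos hε.le hε3) (prop2_row2_div_sq_of (F.P p.K).L_pos hε.le hε2)
    (by have h3 := collar3_le_sideχ_of F ν p g 0 hLM₂; rw [Finset.range_zero, Finset.sum_empty, mul_zero, add_zero, zero_add, pow_one] at h3; exact h3)
    hw hwj hT (sideD_pos_of_one_le F ν M p g 0 hM) hdiv hPC hGi

end Summit.QuantumFields.YangMills.Theorems.BalabanUVNodesN11TStepInnerCentralWindowChartAtRegionsOfScalars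

end
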